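import Literature.NumberTheory.EllipticCurves.CanonicalPAdicHeightSqExistenceProofs
import HarnessLib

/-!
# The squared theta relation at points and non-vanishing for a GIVEN sigma-squared pair (proofs only)

Topic `Literature/NumberTheory/EllipticCurves` (trunk T-NT-EC). Pure proof file (no definition, no
named fact), twin of `CanonicalPAdicHeightSqThetaProofs.lean` in which the CHOSEN sigma-squared function
`padicSigmaSq (W ⊗ ℚ_p)` is replaced by an ARBITRARY sigma-squared pair `(Σ, c)` of `W ⊗ ℚ_p`
(`IsMazurTateSigmaSqPair Σ c`). Width seat `bsd-line-cf2-p1-w5` (g20) of the cell `bsd-print-cf2`, in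
support of stmt-BirchSwinnertonDyer-20368 (road (C), the pinning stub `stub_pin_minusTwist_two`).
BSD is not proved by any of this.

## Why

On an ADDITIVE quadratic twist `W = V^{(d)} ⊗ ℚ₂` of a good ordinary curve a sigma-squared pair exists
(`PadicSigmaSqTwistTransportProofs.lean`: `(D⁻¹𝔖(D/x_W), Dc)`) but is NOT unique (no `a₁`-odd
uniqueness for an additive model), so `padicSigmaSq (W)` — a choice — is not pinned. The point-level
theta relation holds for any given pair:

* §1 (private) evaluation of the two sides of `thetaSq_formal` at a pair of points of the unit disc;
* §2 `padicEval_theta_of_pair` — **`Σ(z(P+Q))·Σ(z(P−Q)) = (x(Q) − x(P))²·Σ(z(P))²·Σ(z(Q))²`** for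
  `P, Q ∈ E(ℚ) ∩ E₁(ℚ_p)` and ANY pair `(Σ, c)`;
* §3 `norm_padicEval_pair_sub_lt` (`‖Σ(t) − t²‖ < ‖t‖²`), `padicEval_pair_ne_zero`,
  `padicEval_pair_param_ne_zero`.

Sequel: `CanonicalPAdicHeightSqOfPairExistenceProofs.lean` (parallelogram law and the height datum).

## Sources

* B. Mazur, J. Tate, Duke Math. J. 62 (1991), Thm. 3.1. [MazurTate1991]
* C. Blakestad, D. Grant, J. Number Theory 249 (2023), Prop. 14, Thm. 15. [BlakestadGrant2023]
* B. Mazur, W. Stein, J. Tate, Doc. Math. Extra Vol. Coates (2006), §2.3, §2.7. [MazurSteinTate2006]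
* J. H. Silverman, Math. Ann. 332 (2005), §5 Rem. 2. [Silverman2005DivPoly]
-/

noncomputable section

open scoped Classical
open PowerSeries Literature.NumberTheory.EllipticCurves

namespace WeierstrassCurve

/-! ### §1 Evaluating the two sides of the squared theta relation (any integral `Σ`) -/

section Eval

variable {p : ℕ} [Fact p.Prime] (V : WeierstrassCurve ℚ_[p]) [hV : V.IsIntegral ℤ_[p]]

variable {V} in
/-- Value of the left side `(Σ(F)·Σ(u -_F v)·u⁴·v⁴)(u, v)` for `Σ ∈ ℤ_p⟦z⟧`, `‖u‖, ‖v‖ < 1` (private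
plumbing, verbatim twin of the tree's evaluation for `padicSigmaSq`). [folklore] -/
private theorem padicEval₂_thetaSqLHS' {Sq : ℚ_[p]⟦X⟧} (hSq : IsPadicInt Sq) {u v : ℚ_[p]} (hu : ‖u‖ < 1)
    (hv : ‖v‖ < 1) :
    padicEval₂ (Sq.subst V.formalGroupLaw * Sq.subst V.formalGroupLawSub *
        (MvPowerSeries.X 0 : MvPowerSeries (Fin 2) ℚ_[p]) ^ 4 * (MvPowerSeries.X 1) ^ 4) u v =
      padicEval Sq (padicEval₂ V.formalGroupLaw u v) *
        padicEval Sq (padicEval₂ V.formalGroupLaw u (padicEval V.formalNeg v)) * u ^ 4 * v ^ 4 := by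
  have hF := V.isPadicInt_formalGroupLaw
  have h1 := hSq.powerSeries_subst hF V.hasSubst_formalGroupLaw
  have hFs := V.isPadicInt_formalGroupLawSub
  have h2 := hSq.powerSeries_subst hFs
    (PowerSeries.HasSubst.of_constantCoeff_zero V.constantCoeff_formalGroupLawSub)
  have hX0 : IsPadicInt ((MvPowerSeries.X 0 : MvPowerSeries (Fin 2) ℚ_[p]) ^ 4) := (IsPadicInt.X 0).pow 4
  have hX1 : IsPadicInt ((MvPowerSeries.X 1 : MvPowerSeries (Fin 2) ℚ_[p]) ^ 4) := (IsPadicInt.X 1).pow 4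
  rw [padicEval₂_mul ((h1.mul h2).mul hX0) hX1 hu hv, padicEval₂_mul (h1.mul h2) hX0 hu hv,
    padicEval₂_mul h1 h2 hu hv, padicEval₂_pow (IsPadicInt.X 0) hu hv, padicEval₂_pow (IsPadicInt.X 1) hu hv,
    padicEval₂_X, padicEval₂_X, padicEval₂_subst hSq hF V.constantCoeff_formalGroupLaw hu hv,
    padicEval₂_subst hSq hFs V.constantCoeff_formalGroupLawSub hu hv]
  unfold formalGroupLawSub
  rw [padicEval₂_substPair hF (IsPadicInt.X 0) (V.isPadicInt_formalNeg.powerSeries_subst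
      (IsPadicInt.X 1) (PowerSeries.HasSubst.X 1)) (MvPowerSeries.constantCoeff_X 0)
      (V.constantCoeff_formalNeg_subst_X 1) hu hv,
    padicEval₂_X, padicEval₂_subst_X V.isPadicInt_formalNeg hu hv]
  rfl

variable {V} in
/-- Value of the right side `((u²X(v) - v²X(u))²·Σ(u)²·Σ(v)²)(u, v)` (private plumbing). [folklore] -/
private theorem padicEval₂_thetaSqRHS' {Sq : ℚ_[p]⟦X⟧} (hSq : IsPadicInt Sq) {u v : ℚ_[p]} (hu : ‖u‖ < 1)
    (hv : ‖v‖ < 1) :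
    padicEval₂ (((MvPowerSeries.X 0 : MvPowerSeries (Fin 2) ℚ_[p]) ^ 2 *
          V.formalXMulSq.subst (MvPowerSeries.X 1 : MvPowerSeries (Fin 2) ℚ_[p]) -
          (MvPowerSeries.X 1) ^ 2 * V.formalXMulSq.subst (MvPowerSeries.X 0 : MvPowerSeries (Fin 2) ℚ_[p])) ^ 2 *
        Sq.subst (MvPowerSeries.X 0 : MvPowerSeries (Fin 2) ℚ_[p]) ^ 2 *
        Sq.subst (MvPowerSeries.X 1 : MvPowerSeries (Fin 2) ℚ_[p]) ^ 2) u v =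
      (u ^ 2 * padicEval V.formalXMulSq v - v ^ 2 * padicEval V.formalXMulSq u) ^ 2 *
        padicEval Sq u ^ 2 * padicEval Sq v ^ 2 := by
  have hXs0 := V.isPadicInt_formalXMulSq.powerSeries_subst (IsPadicInt.X (0 : Fin 2))
    (PowerSeries.HasSubst.X 0)
  have hXs1 := V.isPadicInt_formalXMulSq.powerSeries_subst (IsPadicInt.X (1 : Fin 2))
    (PowerSeries.HasSubst.X 1)
  have hs0 := hSq.powerSeries_subst (IsPadicInt.X (0 : Fin 2)) (PowerSeries.HasSubst.X 0)
  have hs1 := hSq.powerSeries_subst (IsPadicInt.X (1 : Fin 2)) (PowerSeries.HasSubst.X 1)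
  have hX0 : IsPadicInt ((MvPowerSeries.X 0 : MvPowerSeries (Fin 2) ℚ_[p]) ^ 2) := (IsPadicInt.X 0).pow 2
  have hX1 : IsPadicInt ((MvPowerSeries.X 1 : MvPowerSeries (Fin 2) ℚ_[p]) ^ 2) := (IsPadicInt.X 1).pow 2
  have hd := (hX0.mul hXs1).sub (hX1.mul hXs0)
  rw [padicEval₂_mul ((hd.pow 2).mul (hs0.pow 2)) (hs1.pow 2) hu hv, padicEval₂_mul (hd.pow 2) (hs0.pow 2) hu hv,
    padicEval₂_pow hd hu hv, padicEval₂_sub (hX0.mul hXs1) (hX1.mul hXs0) hu hv, padicEval₂_mul hX0 hXs1 hu hv,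
    padicEval₂_mul hX1 hXs0 hu hv, padicEval₂_pow hs0 hu hv, padicEval₂_pow hs1 hu hv,
    padicEval₂_pow (IsPadicInt.X 0) hu hv, padicEval₂_pow (IsPadicInt.X 1) hu hv, padicEval₂_X,
    padicEval₂_X, padicEval₂_subst_X V.isPadicInt_formalXMulSq hu hv,
    padicEval₂_subst_X V.isPadicInt_formalXMulSq hu hv, padicEval₂_subst_X hSq hu hv,
    padicEval₂_subst_X hSq hu hv]
  rfl

end Eval

/-! ### §2 The squared theta relation at rational points, for a GIVEN pair -/

section Points

variable (W : WeierstrassCurve ℚ) [W.IsElliptic] [W.IsIntegral ℤ] (p : ℕ) [Fact p.Prime]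

/-- **The squared theta relation at points for ANY sigma-squared pair `(Σ, c)` of `W ⊗ ℚ_p`**
(not only for the chosen `padicSigmaSq`): for `P = (x₁, y₁)`, `Q = (x₂, y₂) ∈ E(ℚ)` with
`‖x₁‖_p, ‖x₂‖_p > 1`, `Σ(z(P+Q))·Σ(z(P−Q)) = (x₂ − x₁)²·Σ(z(P))²·Σ(z(Q))²` — evaluate the pair's formal
identity `IsMazurTateSigmaSqPair.thetaSq_formal` at `(z(P), z(Q))` and read the group law on points
(`formalGroupLaw_padicEval_holds`). Needed where the pair is NOT unique (additive quadratic twists at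
`p = 2`, `PadicSigmaSqTwistTransportProofs.lean`). [Mazur–Tate 1991, Thm. 3.1; Blakestad–Grant 2023,
Thm. 15; Mazur–Stein–Tate 2006, §2.7] [cite: MazurTate1991, Thm. 3.1] [cite: BlakestadGrant2023, Thm. 15] -/
theorem padicEval_theta_of_pair {Sq : ℚ_[p]⟦X⟧} {c : ℚ_[p]}
    (hpair : (W.baseChange ℚ_[p]).IsMazurTateSigmaSqPair Sq c)
    {x₁ y₁ x₂ y₂ : ℚ} (h₁ : W.toAffine.Nonsingular x₁ y₁) (h₂ : W.toAffine.Nonsingular x₂ y₂)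
    (hx₁ : 1 < ‖(x₁ : ℚ_[p])‖) (hx₂ : 1 < ‖(x₂ : ℚ_[p])‖) :
    padicEval Sq (W.padicParam p (.some x₁ y₁ h₁ + .some x₂ y₂ h₂)) *
        padicEval Sq (W.padicParam p (.some x₁ y₁ h₁ - .some x₂ y₂ h₂)) =
      ((x₂ : ℚ_[p]) - x₁) ^ 2 * padicEval Sq (W.padicParam p (.some x₁ y₁ h₁)) ^ 2 *
        padicEval Sq (W.padicParam p (.some x₂ y₂ h₂)) ^ 2 := by
  set V := W.baseChange ℚ_[p] with hVdef
  have hint : IsPadicInt Sq := hpair.isPadicInt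
  have hΘ := hpair.thetaSq_formal
  have hFadd := formalGroupLaw_padicEval_holds p V
  set ι := W.toPadicPoint p with hιdef
  set P : W.toAffine.Point := .some x₁ y₁ h₁ with hPdef
  set Q : W.toAffine.Point := .some x₂ y₂ h₂ with hQdef
  have hιP : ι P = .some (x₁ : ℚ_[p]) (y₁ : ℚ_[p]) (nonsingular_ratCast h₁) := toPadicPoint_some h₁
  have hιQ : ι Q = .some (x₂ : ℚ_[p]) (y₂ : ℚ_[p]) (nonsingular_ratCast h₂) := toPadicPoint_some h₂
  have hιnQ : ι (-Q) = .some (x₂ : ℚ_[p]) (V.toAffine.negY (x₂ : ℚ_[p]) (y₂ : ℚ_[p]))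
      ((Affine.nonsingular_neg ..).mpr (nonsingular_ratCast h₂)) := by
    rw [map_neg, hιQ, Affine.Point.neg_some]
  have hkP : V.IsInReductionKernel (ι P) := by rw [hιP]; exact hx₁
  have hkQ : V.IsInReductionKernel (ι Q) := by rw [hιQ]; exact hx₂
  have hknQ : V.IsInReductionKernel (ι (-Q)) := by rw [hιnQ]; exact hx₂
  obtain ⟨hy₁, hu0, hu1, -, -⟩ := V.param_facts (nonsingular_ratCast (p := p) h₁).1 hx₁
  obtain ⟨hy₂, hv0, hv1, -, -⟩ := V.param_facts (nonsingular_ratCast (p := p) h₂).1 hx₂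
  set u : ℚ_[p] := -(x₁ : ℚ_[p]) / y₁ with hudef
  set v : ℚ_[p] := -(x₂ : ℚ_[p]) / y₂ with hvdef
  have hzP : V.formalParameter (ι P) = u := by rw [hιP]; rfl
  have hzQ : V.formalParameter (ι Q) = v := by rw [hιQ]; rfl
  have hznQ : V.formalParameter (ι (-Q)) = padicEval V.formalNeg v := by
    rw [hιnQ, V.padicEval_formalNeg_eq (nonsingular_ratCast (p := p) h₂).1 hx₂]; rfl
  have hadd : padicEval₂ V.formalGroupLaw u v = W.padicParam p (P + Q) := by
    rw [← hzP, ← hzQ, hFadd _ _ hkP hkQ, ← map_add, formalParameter_toPadicPoint]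
  have hsub : padicEval₂ V.formalGroupLaw u (padicEval V.formalNeg v) = W.padicParam p (P - Q) := by
    rw [← hzP, ← hznQ, hFadd _ _ hkP hknQ, ← map_add, ← sub_eq_add_neg, formalParameter_toPadicPoint]
  have hXu : padicEval V.formalXMulSq u = (x₁ : ℚ_[p]) * u ^ 2 :=
    V.padicEval_formalXMulSq_eq (nonsingular_ratCast (p := p) h₁).1 hx₁
  have hXv : padicEval V.formalXMulSq v = (x₂ : ℚ_[p]) * v ^ 2 :=
    V.padicEval_formalXMulSq_eq (nonsingular_ratCast (p := p) h₂).1 hx₂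
  have key := congrArg (fun G => padicEval₂ G u v) hΘ
  rw [padicEval₂_thetaSqLHS' hint hu1 hv1, padicEval₂_thetaSqRHS' hint hu1 hv1, hadd, hsub, hXu, hXv] at key
  rw [show W.padicParam p P = u from rfl, show W.padicParam p Q = v from rfl]
  have huv : u ^ 4 * v ^ 4 ≠ 0 := mul_ne_zero (pow_ne_zero 4 hu0) (pow_ne_zero 4 hv0)
  apply mul_right_cancel₀ huv
  linear_combination key

end Points

section Values

variable (W : WeierstrassCurve ℚ) (p : ℕ) [Fact p.Prime]

/-- **`‖Σ(t) − t²‖ < ‖t‖²` for `0 < ‖t‖ < 1` and ANY sigma-squared pair** (`Σ ∈ z² + z³ℤ_p⟦z⟧`).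
[Silverman 2005, §5 Rem. 2; Mazur–Stein–Tate 2006, Thm. 1.3] [cite: Silverman2005DivPoly, §5 Rem. 2] -/
theorem norm_padicEval_pair_sub_lt {Sq : ℚ_[p]⟦X⟧} {c : ℚ_[p]}
    (hpair : (W.baseChange ℚ_[p]).IsMazurTateSigmaSqPair Sq c) {t : ℚ_[p]} (ht0 : t ≠ 0) (ht : ‖t‖ < 1) :
    ‖padicEval Sq t - t ^ 2‖ < ‖t‖ ^ 2 := by
  have hint := hpair.isPadicInt
  have h0 := hpair.constantCoeff_eq
  have h1 := hpair.coeff_one_eq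
  have h2 := hpair.coeff_two_eq
  set G : ℚ_[p]⟦X⟧ := PowerSeries.mk fun n => coeff (n + 2) Sq with hGdef
  have hG : IsPadicInt G := isPadicInt_shift hint 2
  have hSG : Sq = X ^ 2 * G := by
    ext n
    rw [coeff_X_pow_mul']
    split_ifs with hn
    · rw [hGdef, coeff_mk, Nat.sub_add_cancel hn]
    · interval_cases n
      · rw [coeff_zero_eq_constantCoeff_apply]; exact h0
      · exact h1
  have hG0 : constantCoeff G = 1 := by
    rw [← coeff_zero_eq_constantCoeff_apply, hGdef, coeff_mk, zero_add]; exact h2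
  have hGt : ‖padicEval G t - 1‖ < 1 := by
    have := norm_padicEval_sub_constantCoeff_le hG ht
    rw [hG0] at this
    exact this.trans_lt ht
  have hX : IsPadicInt (X : ℚ_[p]⟦X⟧) := IsPadicInt.powerSeries_X
  have heval : padicEval Sq t = t ^ 2 * padicEval G t := by
    rw [hSG, padicEval_mul (hX.pow 2) hG ht, padicEval_pow hX ht 2, padicEval_X]
  rw [heval, ← mul_sub_one, norm_mul, norm_pow]
  exact mul_lt_of_lt_one_right (pow_pos (norm_pos_iff.mpr ht0) 2) hGt

/-- **`Σ(t) ≠ 0` for `0 < ‖t‖ < 1`**, any sigma-squared pair. [cite: Silverman2005DivPoly, §5 Rem. 2] -/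
theorem padicEval_pair_ne_zero {Sq : ℚ_[p]⟦X⟧} {c : ℚ_[p]}
    (hpair : (W.baseChange ℚ_[p]).IsMazurTateSigmaSqPair Sq c) {t : ℚ_[p]} (ht0 : t ≠ 0) (ht : ‖t‖ < 1) :
    padicEval Sq t ≠ 0 := by
  intro h0
  have := W.norm_padicEval_pair_sub_lt p hpair ht0 ht
  rw [h0, zero_sub, norm_neg, norm_pow] at this
  exact lt_irrefl _ this

/-- **`Σ(z(P)) ≠ 0` for `P = (x, y) ∈ E(ℚ) ∩ E₁(ℚ_p)`**, any sigma-squared pair.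
[cite: MazurSteinTate2006, §2.3] -/
theorem padicEval_pair_param_ne_zero [W.IsIntegral ℤ] {Sq : ℚ_[p]⟦X⟧} {c : ℚ_[p]}
    (hpair : (W.baseChange ℚ_[p]).IsMazurTateSigmaSqPair Sq c) {x y : ℚ} (h : W.toAffine.Nonsingular x y)
    (hx : 1 < ‖(x : ℚ_[p])‖) : padicEval Sq (-(x : ℚ_[p]) / y) ≠ 0 := by
  obtain ⟨-, hz0, hz1, -, -⟩ := (W.baseChange ℚ_[p]).param_facts (nonsingular_ratCast (p := p) h).1 hx
  exact W.padicEval_pair_ne_zero p hpair hz0 hz1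

end Values

end WeierstrassCurve
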